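import Summits.Ventures.HodgeKum4.Theses.KummerFixedLocus
import Summits.Ventures.HodgeKum4.Theorems.KummerFixedLocusAndreDischarged
import HarnessLib

/-!
# Birth skeleton (line `birth`) for the crux `MotivicBookkeepingKum4` — L2, item stmt-Ventures-19136

Decl `Summit.Ventures.HodgeKum4.Theses.KummerFixedLocus.MotivicBookkeepingKum4`
(`= Summit.Ventures.HodgeKum4.MotivicBookkeepingKum4 := LefschetzGenerationKum4 → InvariantHodgeClassesAlgebraicKum4`:
given L1, every `Γ(X)`-invariant rational `(p,p)`-class of a smooth projective `Kum⁴`-type `X` is algebraic).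
Route `KummerFixedLocus`, cell `hodge-kum4`; planner plate (R6) of director-hodge g8, 2026-08-27T12:16:42Z.

THE LINE (the DIRECT road — invariants only, no use of L3°): by p2's LANDED conditional theorem
`gammaInvariantsDominatedKum4_of_facts'` (`Theorems/KummerFixedLocusAndreDischarged.lean`; André's input discharged in
the tree), THREE REFEREED printed facts — O'Grady 2021 Thm. 1.5 + Markman 2023 Thm. 1.4 + Voisin 2022 Thm. 4.1
(`Hyperkaehler.OGradyVoisin2022_thirdJacobian_kugaSatake_kummerType`: `T = J³(X)` a disc-1 Weil fourfold with algebraic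
`H¹(T) ≅ H³(X)` and `H⁶(T) ↠ H¹⁴(X)`), Floccari–Fu 2026 Thm. 1.2 (`HodgeTheory.FloccariFu2026_…discOneWeilFourfold`: HC
for all powers of disc-1 Weil fourfolds) and Foster 2024 Cor. 2 (`Hyperkaehler.Foster2024_lefschetzStandard_kummerType_prime`:
`B(X)`) — give, TOGETHER WITH L1, that the `Γ(X)`-invariant classes are DOMINATED by the powers of `T`
(`GammaInvariantsDominatedKum4`: they lie in `dominatedClasses 8 X 4 T k`, the span of images of algebraic
correspondences `H(Tᵉ) → Hᵏ(X)`; the cup ∕ composition closure of dominated classes — `opCupSpan_le_totalDominated`,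
`Theorems/KummerFixedLocusDominatedSpan.lean` — is already a theorem of the tree and is consumed inside p2's proof).
What remains is ONE kernel lemma, Arapura 2006 Lem. 4.2 in IMAGE form: a rational `(p,p)`-class lying in
`dominatedClasses` is algebraic when the Hodge conjecture holds on the powers of `T` (the tree proves the `= ⊤` form,
`CorCM/Stage4StrictRoadDischarge.hodgeConjectureFor_of_isDominatedByPowers`, by an engine — Voisin's Cor. 2.12 with
integer twists `exists_isRationalClass_isOfHodgeType_eq_sum_int`, `corrAction_mem_algebraicClasses_complex` — that
proves the image form on the way).

REGISTERED STUBS (2): `stub_print` (the three printed facts, BY NAME, as ONE conjunction — the laneV convention) and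
`stub_dominatedHodge` (the image-form Arapura lemma).  COMPOSITION `motivicBookkeepingKum4_of_stubs` (kernel-checked,
five lines over `gammaInvariantsDominatedKum4_of_facts'`) and `MotivicBookkeepingKum4_of` concluding the route decl BY NAME.
ZERO-WORK ALTERNATIVE (not registered): p2's `motivicBookkeepingKum4_of_facts_of_fixedLocus'` closes L2 from the same
three facts AND the route nodes F_Γ, F_Γ′, L3° (all of `H*(X)` dominated ⟹ Arapura `= ⊤` form) — i.e. L2 follows L3°
modulo print with no kernel work; the line registered here makes L2 independent of L3°.
HONEST FRAMING: conditional on the two stubs; nothing here says L2 ∕ L1 ∕ HC_Kum4Type ∕ HC is proved.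
-/

noncomputable section

open Literature.AlgebraicTopology.SingularHomology
open Literature.AlgebraicGeometry Literature.AlgebraicGeometry.HodgeTheory Literature.AlgebraicGeometry.Hyperkaehler

namespace Summit.Ventures.HodgeKum4.Cruxes.MotivicBookkeepingKum4.Birth

open Summit.Ventures.HodgeKum4

/-! ### The two stub statements -/

/-- **S-P (print)**: the three REFEREED printed inputs of the direct road, BY NAME. -/
def Print : Prop :=
  OGradyVoisin2022_thirdJacobian_kugaSatake_kummerType ∧
    FloccariFu2026_hodgeClasses_algebraic_powers_discOneWeilFourfold ∧
      Foster2024_lefschetzStandard_kummerType_prime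

/-- **S-K (kernel; Arapura 2006 Lem. 4.2 ∕ 1.1 in IMAGE form)**: for `B`, `Y` smooth projective with the Hodge
conjecture on all powers `B^{m+1}`, a rational `(p,p)`-class of `Y` lying in `dominatedClasses dY Y dB B (2p)` — the
`ℂ`-span of the images of algebraic correspondences `Hᵃ(Bᵉ) → H²ᵖ(Y)` — is algebraic. -/
def DominatedHodgeClassesAlgebraic : Prop :=
  ∀ ⦃dB : ℕ⦄ ⦃B : Motives.SchemeOver ℂ⦄ ⦃dY : ℕ⦄ ⦃Y : Motives.SchemeOver ℂ⦄,
    Motives.IsSmoothProjective dB B → Motives.IsSmoothProjective dY Y →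
      (∀ m : ℕ, HodgeConjectureFor ((m + 1) * dB) (B.pow (m + 1))) →
        ∀ (p : ℕ) (c : complexBetti Y (2 * p)), IsRationalClass c → IsOfHodgeType dY Y (2 * p) p p c →
          c ∈ dominatedClasses dY Y dB B (2 * p) → c ∈ algebraicClasses Y p

/-! ### Registered stubs -/

/-- STUB `stub_print` (print; held ∕ vendoring): O'Grady 2021 Thm. 1.5 + Markman 2023 Thm. 1.4 + Voisin 2022 Thm. 4.1;
Floccari–Fu 2026 Thm. 1.2 (= Floccari 2026 Thm. 5.12); Foster 2024 Cor. 2. -/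
theorem stub_print : Print := by
  sorry

/-- STUB `stub_dominatedHodge` (kernel; size M): reduce to RATIONAL algebraic correspondences acting through the complex
orientations (algebraic classes are the `ℂ`-span of the rational ones; a rational vector in the complexification of a
`ℚ`-subspace lies in it), then Voisin's Cor. 2.12 with integer twists (`exists_isRationalClass_isOfHodgeType_eq_sum_int`:
`c = Σᵢ (γᵢ)_* aᵢ` with `aᵢ` rational of type `(dᵢ,dᵢ)`), HC on `B^{eᵢ}`, and `(γᵢ)_*` preserves algebraic classes
(`corrAction_mem_algebraicClasses_complex`) — the engine of `CorCM/Stage4StrictRoadDischarge`, read on a subspace. -/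
theorem stub_dominatedHodge : DominatedHodgeClassesAlgebraic := by
  sorry

/-! ### The composition (kernel-checked) -/

/-- **L2 from the two stubs**, over p2's landed `gammaInvariantsDominatedKum4_of_facts'` (L1 + three facts ⟹ the
invariants are dominated by the powers of `J³(X)`, with HC on those powers). -/
theorem motivicBookkeepingKum4_of_stubs (hP : Print) (hD : DominatedHodgeClassesAlgebraic) :
    Summit.Ventures.HodgeKum4.MotivicBookkeepingKum4 := by
  obtain ⟨hOGV, hFF, hFo⟩ := hP
  intro h1 X hX hK p c hrat hpp hinv
  obtain ⟨B, hB, hHC, hdom⟩ := gammaInvariantsDominatedKum4_of_facts' hOGV hFF hFo h1 hX hK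
  exact hD hB hX hHC p c hrat hpp (hdom (2 * p) c hinv)

/-- **Composition for the route item** `MotivicBookkeepingKum4`, BY NAME. -/
theorem MotivicBookkeepingKum4_of : Summit.Ventures.HodgeKum4.Theses.KummerFixedLocus.MotivicBookkeepingKum4 :=
  motivicBookkeepingKum4_of_stubs stub_print stub_dominatedHodge

end Summit.Ventures.HodgeKum4.Cruxes.MotivicBookkeepingKum4.Birth

end
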